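import Summits.BirchSwinnertonDyer.Rank1Residual.X12.JZeroThreeDescent
import Summits.BirchSwinnertonDyer.Rank1Residual.X12.InertCoreInstancesA
import Summits.BirchSwinnertonDyer.Rank1Residual.X12.InertCoreInstancesB
import Summits.BirchSwinnertonDyer.Rank1Residual.X12.InertCoreInstancesF
import HarnessLib

/-!
# K12r@3 (`j = 0`, CM by `ℚ(√−3)`, `ord_{s=1} L(E,s) = 1`, `p = 3` RAMIFIED): per-class kernel records (C)
# — `3600bd1`, `3600be1`, `3888p1`, `3888s1`, `4356a1`, `4356b1`, `4356c1`, `4563a1`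
# (cell `bsd-print-cfram`, seat p4; window `N < 2·10⁴` of the leaf `WAllCornerFRamifiedAtThree`)

HONEST FRAMING (cell `bsd-print-cfram`, run/shared/lean/pub/bsd-print-cfram/, D-0131 (2) print
tier; verbatim in every file of the seat): the cell works the partition leaf
`CornerF ∧ p ramified in the CM field K` (LADDER-BSD row K7r = B13; W-ALL row 12r) in PARTITION
currency — a leaf or a cell counts only when its theorem is in the kernel BY NAME. NO class-wide
theorem for the `p = 3` slice is in print (bsd-wall-cm K12R3-SCOPING-v1 §3); these are PER-CLASS
records, one per isogeny class of the window `N < 2·10⁴` not already booked through a printed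
family (Kriz–Li sextic twists / cube sums: 13 classes), in the booking shape of
`X12/JZeroThreeDescent.lean` (`JZeroThree.bsdp_three_of_noThreeTorsion`, seam
`X12.bsdp_of_sha_torsion_eq_zero` p220351). Definitions = Cremona's minimal models (data);
theorems only otherwise; no named fact; nothing about any curve is ASSERTED — the per-class inputs
enter as hypotheses: `hr` (`ord_{s=1} L(E,s) ≤ 1`; Cremona: `= 1`), `h0` (`Ш(E/ℚ)[3] = 0`: the
CERTIFICATE), `hq`/`hv` (`#Ш_an(E) = q`, `ord₃ q = 0`; Cremona: `#Ш_an = 1` on every member of every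
class below). beyond-print: NO (certificate assembly).

THE CERTIFICATE behind `h0` (two engines, two seats, two code bases; numbers quoted per record):
the `3`-isogeny descent along `φ : E_k → E_{−27k}` (`E_k : y² = x³ + k` the `j = 0` member,
kernel `⟨(0, ±√k)⟩`): `s_φ = dim_𝔽₃ Sel^φ(E_k)`, `s_φ̂ = dim_𝔽₃ Sel^φ̂(E_{−27k})`,
`m = rank + [k ∈ ℚ²] + [−3k ∈ ℚ²]`, `EXCESS = s_φ + s_φ̂ − m = dim Ш(E_k)[φ] + dim Ш(E_{−27k})[φ̂]`;
EXCESS `0` ⟹ `Ш(E_k)[3] = 0 = Ш(E_{−27k})[3]`. Engine 1: x1b `x12sel3.gp` (Kummer images in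
`K(S′,3)`, `bnfcertify`d, local images to the printed size [Schaefer 1996 L.3.8 = BES 2020 Prop. 27],
Cassels' Selmer-ratio identity and BES Prop. 28 checked on every edge), kit j101548 = j101531;
engine 2: sha-2 `iso3kum.gp` run by harvest-1, kit j103487 = j103505; the two engines agree on
`(s_φ, s_φ̂)` on all 1838 members of the 919 classes `N < 5·10⁵` (x1b X12-ROUTE.md §17, harvest-1
GEN 25). `Ш(E)[3] = 0` is a `ℚ`-isogeny invariant inside these classes only through BSD — the record
states it for Cremona's curve 1 (= a `j = 0` member `E_k` up to `ℚ`-isomorphism, `k` quoted), on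
which both engines computed it directly.

Per record: model (new, or REUSED by name with its instances), `IsElliptic`, `IsGloballyMinimal`
(Kraus–Silverman, kernel-decided), `j = 0`, the leaf cell `cornerF_three_<name>`, and
`bsdp_three_<name>` = `BSD(E, 3) ∧ #Ш(E/ℚ)[3^∞] = 1` under `hGZK`, `hr`, `h0`, `hq`, `hv`; the class
form is `JZeroThree.bsdp_three_of_isIsogenous_of_noThreeTorsion` on the same hypotheses.

References: `X12/JZeroThreeDescent.lean`; `X12/MillerStollRecords.lean` §1; `X12/InertCoreInstancesA.lean`
§0 (record conventions); [cite: Cremona1997, Table 1]; [cite: Miller2011LMS, §1 and Def. 1.1];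
[cite: SilvermanAEC2009, VII.1 Remark 1.1 and X.4]; x1b `gen13/sel3j0/SEL3J0-MEMBERS-1838.tsv`
(sha256 in that folder's SHA256SUMS).
-/

set_option autoImplicit false

noncomputable section

open scoped Classical

open WeierstrassCurve Literature.NumberTheory.EllipticCurves
  Literature.NumberTheory.EllipticCurves.ModularForms
  Literature.NumberTheory.EllipticCurves.Rank1Residual
  Literature.NumberTheory.EllipticCurves.Rank1Residual.Typed
  Literature.NumberTheory.EllipticCurves.Rank1Residual.X11RankOneCertificates
  Summit.BirchSwinnertonDyer.BirchSwinnertonDyer.Rank1Residual.X11RankOne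
  Summit.BirchSwinnertonDyer.Rank1Residual.X11b

namespace Summit.BirchSwinnertonDyer.Rank1Residual.X12

/-! ### `3600bd1 @ 3` (class `3600bd`, `N = 3600 = 2⁴·3²·5²`) -/
namespace Records
/-! Model `c3600bd1 = [0, 0, 0, 0, -100]` (`y² = x³ − 100`; `k = -100`; Cremona: rank `1`, `#E(ℚ)_tors = 1`,
`∏ c_ℓ = 12`, `#Ш_an = 1`) with its `IsElliptic` / `IsGloballyMinimal` instances is REUSED from
`InertCoreInstancesB.lean`. -/

/-- `j(3600bd1) = 0` (`c₄ = 0`). [cite: Cremona1997, Table 1 (curve 3600bd1)] -/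
theorem c3600bd1_j : c3600bd1.j = 0 := by
  have hc4 : c3600bd1.c₄ = 0 := by
    norm_num [c3600bd1, WeierstrassCurve.c₄, WeierstrassCurve.b₂, WeierstrassCurve.b₄]
  rw [WeierstrassCurve.j, hc4]
  simp

end Records

/-- **`(3600bd1, 3)` is a cell of the leaf `CornerF ∧ CMRamified` at `3`** (CM by `ℚ(√−3)`,
`r_an = 1`, `3` bad and ramified), given `ord_{s=1} L(E,s) = 1` (`hr`; Cremona). [folklore] -/
theorem cornerF_three_c3600bd1 (hr : Records.c3600bd1.analyticRank = 1) : CornerF Records.c3600bd1 3 :=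
  JZeroThree.cornerF_three_of_j_eq_zero _ Records.c3600bd1_j hr

/-- **`BSD(3600bd1, 3)` and `#Ш(3600bd1/ℚ)[3^∞] = 1`** from GZK (`hGZK`), `ord_{s=1} L(E,s) ≤ 1`
(`hr`), the two-engine `3`-isogeny-descent certificate `Ш(E/ℚ)[3] = 0` (`h0`; 3600bd1: k = -100, (s_φ, s_φ̂, m, EXCESS) = (0, 1, 1, 0); 3600bd2: k = 2700, (s_φ, s_φ̂, m, EXCESS) = (1, 0, 1, 0);
engines x1b j101548 / sha-2 j103487, agreeing) and `#Ш_an = q`, `ord₃ q = 0` (`hq`, `hv`; Cremona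
`#Ш_an`: 3600bd1 1, 3600bd2 1). PER CLASS; nothing asserted. [cite: Miller2011LMS, §1 and Def. 1.1]
[cite: Cremona1997, Table 1 (class 3600bd)] -/
theorem bsdp_three_c3600bd1 (hGZK : rank_eq_analyticRank_of_analyticRank_le_one)
    (hr : Records.c3600bd1.analyticRank ≤ 1) (h0 : ∀ x : ↥Records.c3600bd1.sha, 3 • x = 0 → x = 0)
    {q : ℚ} (hq : shaAn Records.c3600bd1 = (q : ℂ)) (hv : padicValRat 3 q = 0) :
    BSDp Records.c3600bd1 3 ∧ Nat.card (AddCommGroup.primaryComponent Records.c3600bd1.sha 3) = 1 :=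
  JZeroThree.bsdp_three_of_noThreeTorsion _ hGZK hr h0 hq hv

/-! ### `3600be1 @ 3` (class `3600be`, `N = 3600 = 2⁴·3²·5²`) -/
namespace Records
/-! Model `c3600be1 = [0, 0, 0, 0, -10000]` (`y² = x³ − 10000`; `k = -10000`; Cremona: rank `1`, `#E(ℚ)_tors = 1`,
`∏ c_ℓ = 6`, `#Ш_an = 1`) with its `IsElliptic` / `IsGloballyMinimal` instances is REUSED from
`InertCoreInstancesB.lean`. -/

/-- `j(3600be1) = 0` (`c₄ = 0`). [cite: Cremona1997, Table 1 (curve 3600be1)] -/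
theorem c3600be1_j : c3600be1.j = 0 := by
  have hc4 : c3600be1.c₄ = 0 := by
    norm_num [c3600be1, WeierstrassCurve.c₄, WeierstrassCurve.b₂, WeierstrassCurve.b₄]
  rw [WeierstrassCurve.j, hc4]
  simp

end Records

/-- **`(3600be1, 3)` is a cell of the leaf `CornerF ∧ CMRamified` at `3`** (CM by `ℚ(√−3)`,
`r_an = 1`, `3` bad and ramified), given `ord_{s=1} L(E,s) = 1` (`hr`; Cremona). [folklore] -/
theorem cornerF_three_c3600be1 (hr : Records.c3600be1.analyticRank = 1) : CornerF Records.c3600be1 3 :=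
  JZeroThree.cornerF_three_of_j_eq_zero _ Records.c3600be1_j hr

/-- **`BSD(3600be1, 3)` and `#Ш(3600be1/ℚ)[3^∞] = 1`** from GZK (`hGZK`), `ord_{s=1} L(E,s) ≤ 1`
(`hr`), the two-engine `3`-isogeny-descent certificate `Ш(E/ℚ)[3] = 0` (`h0`; 3600be1: k = -10000, (s_φ, s_φ̂, m, EXCESS) = (0, 1, 1, 0); 3600be2: k = 270000, (s_φ, s_φ̂, m, EXCESS) = (1, 0, 1, 0);
engines x1b j101548 / sha-2 j103487, agreeing) and `#Ш_an = q`, `ord₃ q = 0` (`hq`, `hv`; Cremona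
`#Ш_an`: 3600be1 1, 3600be2 1). PER CLASS; nothing asserted. [cite: Miller2011LMS, §1 and Def. 1.1]
[cite: Cremona1997, Table 1 (class 3600be)] -/
theorem bsdp_three_c3600be1 (hGZK : rank_eq_analyticRank_of_analyticRank_le_one)
    (hr : Records.c3600be1.analyticRank ≤ 1) (h0 : ∀ x : ↥Records.c3600be1.sha, 3 • x = 0 → x = 0)
    {q : ℚ} (hq : shaAn Records.c3600be1 = (q : ℂ)) (hv : padicValRat 3 q = 0) :
    BSDp Records.c3600be1 3 ∧ Nat.card (AddCommGroup.primaryComponent Records.c3600be1.sha 3) = 1 :=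
  JZeroThree.bsdp_three_of_noThreeTorsion _ hGZK hr h0 hq hv

/-! ### `3888p1 @ 3` (class `3888p`, `N = 3888 = 2⁴·3⁵`) -/
namespace Records
/-- Cremona `3888p1 = [0, 0, 0, 0, 12]`: `y² = x³ + 12` (`N = 3888 = 2⁴·3⁵`, `j = 0`, CM by `ℤ[ζ₃]`;
`≅ E_k : y² = x³ + k` with `k = 12`; Cremona: rank `1`, `#E(ℚ)_tors = 1`, `∏ c_ℓ = 2`,
`#Ш_an = 1`). [cite: Cremona1997, Table 1 (curve 3888p1)] -/
def c3888p1 : WeierstrassCurve ℚ := ⟨0, 0, 0, 0, 12⟩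

/-- `3888p1` is an elliptic curve (`Δ = -62208 ≠ 0`). [cite: SilvermanAEC2009, III.1] -/
instance isElliptic_c3888p1 : c3888p1.IsElliptic := by
  have h := isElliptic_of_discOf_ne_zero 0 0 0 0 12 (by decide)
  norm_num at h; exact h

set_option maxRecDepth 100000 in
/-- `[0, 0, 0, 0, 12]` is globally minimal (`Δ = -62208`; Kraus–Silverman criterion, kernel-decided).
[cite: SilvermanAEC2009, VII.1 Remark 1.1 and VIII.8] -/
instance isGloballyMinimal_c3888p1 : c3888p1.IsGloballyMinimal := by
  have h := isGloballyMinimal_of_krausCriterion_bounded 0 0 0 0 12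
    (by decide) (by decide) (by decide +kernel)
  norm_num at h; exact h

/-- `j(3888p1) = 0` (`c₄ = 0`). [cite: Cremona1997, Table 1 (curve 3888p1)] -/
theorem c3888p1_j : c3888p1.j = 0 := by
  have hc4 : c3888p1.c₄ = 0 := by
    norm_num [c3888p1, WeierstrassCurve.c₄, WeierstrassCurve.b₂, WeierstrassCurve.b₄]
  rw [WeierstrassCurve.j, hc4]
  simp

end Records

/-- **`(3888p1, 3)` is a cell of the leaf `CornerF ∧ CMRamified` at `3`** (CM by `ℚ(√−3)`,
`r_an = 1`, `3` bad and ramified), given `ord_{s=1} L(E,s) = 1` (`hr`; Cremona). [folklore] -/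
theorem cornerF_three_c3888p1 (hr : Records.c3888p1.analyticRank = 1) : CornerF Records.c3888p1 3 :=
  JZeroThree.cornerF_three_of_j_eq_zero _ Records.c3888p1_j hr

/-- **`BSD(3888p1, 3)` and `#Ш(3888p1/ℚ)[3^∞] = 1`** from GZK (`hGZK`), `ord_{s=1} L(E,s) ≤ 1`
(`hr`), the two-engine `3`-isogeny-descent certificate `Ш(E/ℚ)[3] = 0` (`h0`; 3888p1: k = 12, (s_φ, s_φ̂, m, EXCESS) = (0, 1, 1, 0); 3888p2: k = -324, (s_φ, s_φ̂, m, EXCESS) = (1, 0, 1, 0);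
engines x1b j101548 / sha-2 j103487, agreeing) and `#Ш_an = q`, `ord₃ q = 0` (`hq`, `hv`; Cremona
`#Ш_an`: 3888p1 1, 3888p2 1). PER CLASS; nothing asserted. [cite: Miller2011LMS, §1 and Def. 1.1]
[cite: Cremona1997, Table 1 (class 3888p)] -/
theorem bsdp_three_c3888p1 (hGZK : rank_eq_analyticRank_of_analyticRank_le_one)
    (hr : Records.c3888p1.analyticRank ≤ 1) (h0 : ∀ x : ↥Records.c3888p1.sha, 3 • x = 0 → x = 0)
    {q : ℚ} (hq : shaAn Records.c3888p1 = (q : ℂ)) (hv : padicValRat 3 q = 0) :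
    BSDp Records.c3888p1 3 ∧ Nat.card (AddCommGroup.primaryComponent Records.c3888p1.sha 3) = 1 :=
  JZeroThree.bsdp_three_of_noThreeTorsion _ hGZK hr h0 hq hv

/-! ### `3888s1 @ 3` (class `3888s`, `N = 3888 = 2⁴·3⁵`) -/
namespace Records
/-- Cremona `3888s1 = [0, 0, 0, 0, 48]`: `y² = x³ + 48` (`N = 3888 = 2⁴·3⁵`, `j = 0`, CM by `ℤ[ζ₃]`;
`≅ E_k : y² = x³ + k` with `k = 48`; Cremona: rank `1`, `#E(ℚ)_tors = 1`, `∏ c_ℓ = 1`,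
`#Ш_an = 1`). [cite: Cremona1997, Table 1 (curve 3888s1)] -/
def c3888s1 : WeierstrassCurve ℚ := ⟨0, 0, 0, 0, 48⟩

/-- `3888s1` is an elliptic curve (`Δ = -995328 ≠ 0`). [cite: SilvermanAEC2009, III.1] -/
instance isElliptic_c3888s1 : c3888s1.IsElliptic := by
  have h := isElliptic_of_discOf_ne_zero 0 0 0 0 48 (by decide)
  norm_num at h; exact h

set_option maxRecDepth 100000 in
/-- `[0, 0, 0, 0, 48]` is globally minimal (`Δ = -995328`; Kraus–Silverman criterion, kernel-decided).
[cite: SilvermanAEC2009, VII.1 Remark 1.1 and VIII.8] -/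
instance isGloballyMinimal_c3888s1 : c3888s1.IsGloballyMinimal := by
  have h := isGloballyMinimal_of_krausCriterion_bounded 0 0 0 0 48
    (by decide) (by decide) (by decide +kernel)
  norm_num at h; exact h

/-- `j(3888s1) = 0` (`c₄ = 0`). [cite: Cremona1997, Table 1 (curve 3888s1)] -/
theorem c3888s1_j : c3888s1.j = 0 := by
  have hc4 : c3888s1.c₄ = 0 := by
    norm_num [c3888s1, WeierstrassCurve.c₄, WeierstrassCurve.b₂, WeierstrassCurve.b₄]
  rw [WeierstrassCurve.j, hc4]
  simp

end Records

/-- **`(3888s1, 3)` is a cell of the leaf `CornerF ∧ CMRamified` at `3`** (CM by `ℚ(√−3)`,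
`r_an = 1`, `3` bad and ramified), given `ord_{s=1} L(E,s) = 1` (`hr`; Cremona). [folklore] -/
theorem cornerF_three_c3888s1 (hr : Records.c3888s1.analyticRank = 1) : CornerF Records.c3888s1 3 :=
  JZeroThree.cornerF_three_of_j_eq_zero _ Records.c3888s1_j hr

/-- **`BSD(3888s1, 3)` and `#Ш(3888s1/ℚ)[3^∞] = 1`** from GZK (`hGZK`), `ord_{s=1} L(E,s) ≤ 1`
(`hr`), the two-engine `3`-isogeny-descent certificate `Ш(E/ℚ)[3] = 0` (`h0`; 3888s1: k = 48, (s_φ, s_φ̂, m, EXCESS) = (0, 1, 1, 0); 3888s2: k = -1296, (s_φ, s_φ̂, m, EXCESS) = (1, 0, 1, 0);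
engines x1b j101548 / sha-2 j103487, agreeing) and `#Ш_an = q`, `ord₃ q = 0` (`hq`, `hv`; Cremona
`#Ш_an`: 3888s1 1, 3888s2 1). PER CLASS; nothing asserted. [cite: Miller2011LMS, §1 and Def. 1.1]
[cite: Cremona1997, Table 1 (class 3888s)] -/
theorem bsdp_three_c3888s1 (hGZK : rank_eq_analyticRank_of_analyticRank_le_one)
    (hr : Records.c3888s1.analyticRank ≤ 1) (h0 : ∀ x : ↥Records.c3888s1.sha, 3 • x = 0 → x = 0)
    {q : ℚ} (hq : shaAn Records.c3888s1 = (q : ℂ)) (hv : padicValRat 3 q = 0) :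
    BSDp Records.c3888s1 3 ∧ Nat.card (AddCommGroup.primaryComponent Records.c3888s1.sha 3) = 1 :=
  JZeroThree.bsdp_three_of_noThreeTorsion _ hGZK hr h0 hq hv

/-! ### `4356a1 @ 3` (class `4356a`, `N = 4356 = 2²·3²·11²`) -/
namespace Records
/-! Model `c4356a1 = [0, 0, 0, 0, -44]` (`y² = x³ − 44`; `k = -44`; Cremona: rank `1`, `#E(ℚ)_tors = 1`,
`∏ c_ℓ = 2`, `#Ш_an = 1`) with its `IsElliptic` / `IsGloballyMinimal` instances is REUSED from
`InertCoreInstancesF.lean`. -/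

/-- `j(4356a1) = 0` (`c₄ = 0`). [cite: Cremona1997, Table 1 (curve 4356a1)] -/
theorem c4356a1_j : c4356a1.j = 0 := by
  have hc4 : c4356a1.c₄ = 0 := by
    norm_num [c4356a1, WeierstrassCurve.c₄, WeierstrassCurve.b₂, WeierstrassCurve.b₄]
  rw [WeierstrassCurve.j, hc4]
  simp

end Records

/-- **`(4356a1, 3)` is a cell of the leaf `CornerF ∧ CMRamified` at `3`** (CM by `ℚ(√−3)`,
`r_an = 1`, `3` bad and ramified), given `ord_{s=1} L(E,s) = 1` (`hr`; Cremona). [folklore] -/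
theorem cornerF_three_c4356a1 (hr : Records.c4356a1.analyticRank = 1) : CornerF Records.c4356a1 3 :=
  JZeroThree.cornerF_three_of_j_eq_zero _ Records.c4356a1_j hr

/-- **`BSD(4356a1, 3)` and `#Ш(4356a1/ℚ)[3^∞] = 1`** from GZK (`hGZK`), `ord_{s=1} L(E,s) ≤ 1`
(`hr`), the two-engine `3`-isogeny-descent certificate `Ш(E/ℚ)[3] = 0` (`h0`; 4356a1: k = -44, (s_φ, s_φ̂, m, EXCESS) = (1, 0, 1, 0); 4356a2: k = 1188, (s_φ, s_φ̂, m, EXCESS) = (0, 1, 1, 0);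
engines x1b j101548 / sha-2 j103487, agreeing) and `#Ш_an = q`, `ord₃ q = 0` (`hq`, `hv`; Cremona
`#Ш_an`: 4356a1 1, 4356a2 1). PER CLASS; nothing asserted. [cite: Miller2011LMS, §1 and Def. 1.1]
[cite: Cremona1997, Table 1 (class 4356a)] -/
theorem bsdp_three_c4356a1 (hGZK : rank_eq_analyticRank_of_analyticRank_le_one)
    (hr : Records.c4356a1.analyticRank ≤ 1) (h0 : ∀ x : ↥Records.c4356a1.sha, 3 • x = 0 → x = 0)
    {q : ℚ} (hq : shaAn Records.c4356a1 = (q : ℂ)) (hv : padicValRat 3 q = 0) :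
    BSDp Records.c4356a1 3 ∧ Nat.card (AddCommGroup.primaryComponent Records.c4356a1.sha 3) = 1 :=
  JZeroThree.bsdp_three_of_noThreeTorsion _ hGZK hr h0 hq hv

/-! ### `4356b1 @ 3` (class `4356b`, `N = 4356 = 2²·3²·11²`) -/
namespace Records
/-! Model `c4356b1 = [0, 0, 0, 0, 58564]` (`y² = x³ + 58564`; `k = 58564`; Cremona: rank `1`, `#E(ℚ)_tors = 3`,
`∏ c_ℓ = 18`, `#Ш_an = 1`) with its `IsElliptic` / `IsGloballyMinimal` instances is REUSED from
`InertCoreInstancesF.lean`. -/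

/-- `j(4356b1) = 0` (`c₄ = 0`). [cite: Cremona1997, Table 1 (curve 4356b1)] -/
theorem c4356b1_j : c4356b1.j = 0 := by
  have hc4 : c4356b1.c₄ = 0 := by
    norm_num [c4356b1, WeierstrassCurve.c₄, WeierstrassCurve.b₂, WeierstrassCurve.b₄]
  rw [WeierstrassCurve.j, hc4]
  simp

end Records

/-- **`(4356b1, 3)` is a cell of the leaf `CornerF ∧ CMRamified` at `3`** (CM by `ℚ(√−3)`,
`r_an = 1`, `3` bad and ramified), given `ord_{s=1} L(E,s) = 1` (`hr`; Cremona). [folklore] -/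
theorem cornerF_three_c4356b1 (hr : Records.c4356b1.analyticRank = 1) : CornerF Records.c4356b1 3 :=
  JZeroThree.cornerF_three_of_j_eq_zero _ Records.c4356b1_j hr

/-- **`BSD(4356b1, 3)` and `#Ш(4356b1/ℚ)[3^∞] = 1`** from GZK (`hGZK`), `ord_{s=1} L(E,s) ≤ 1`
(`hr`), the two-engine `3`-isogeny-descent certificate `Ш(E/ℚ)[3] = 0` (`h0`; 4356b1: k = 58564, (s_φ, s_φ̂, m, EXCESS) = (0, 2, 2, 0); 4356b2: k = -1581228, (s_φ, s_φ̂, m, EXCESS) = (2, 0, 2, 0);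
engines x1b j101548 / sha-2 j103487, agreeing) and `#Ш_an = q`, `ord₃ q = 0` (`hq`, `hv`; Cremona
`#Ш_an`: 4356b1 1, 4356b2 1). PER CLASS; nothing asserted. [cite: Miller2011LMS, §1 and Def. 1.1]
[cite: Cremona1997, Table 1 (class 4356b)] -/
theorem bsdp_three_c4356b1 (hGZK : rank_eq_analyticRank_of_analyticRank_le_one)
    (hr : Records.c4356b1.analyticRank ≤ 1) (h0 : ∀ x : ↥Records.c4356b1.sha, 3 • x = 0 → x = 0)
    {q : ℚ} (hq : shaAn Records.c4356b1 = (q : ℂ)) (hv : padicValRat 3 q = 0) :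
    BSDp Records.c4356b1 3 ∧ Nat.card (AddCommGroup.primaryComponent Records.c4356b1.sha 3) = 1 :=
  JZeroThree.bsdp_three_of_noThreeTorsion _ hGZK hr h0 hq hv

/-! ### `4356c1 @ 3` (class `4356c`, `N = 4356 = 2²·3²·11²`) -/
namespace Records
/-! Model `c4356c1 = [0, 0, 0, 0, -1331]` (`y² = x³ − 1331`; `k = -1331`; Cremona: rank `1`, `#E(ℚ)_tors = 2`,
`∏ c_ℓ = 4`, `#Ш_an = 1`) with its `IsElliptic` / `IsGloballyMinimal` instances is REUSED from
`InertCoreInstancesF.lean`. -/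

/-- `j(4356c1) = 0` (`c₄ = 0`). [cite: Cremona1997, Table 1 (curve 4356c1)] -/
theorem c4356c1_j : c4356c1.j = 0 := by
  have hc4 : c4356c1.c₄ = 0 := by
    norm_num [c4356c1, WeierstrassCurve.c₄, WeierstrassCurve.b₂, WeierstrassCurve.b₄]
  rw [WeierstrassCurve.j, hc4]
  simp

end Records

/-- **`(4356c1, 3)` is a cell of the leaf `CornerF ∧ CMRamified` at `3`** (CM by `ℚ(√−3)`,
`r_an = 1`, `3` bad and ramified), given `ord_{s=1} L(E,s) = 1` (`hr`; Cremona). [folklore] -/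
theorem cornerF_three_c4356c1 (hr : Records.c4356c1.analyticRank = 1) : CornerF Records.c4356c1 3 :=
  JZeroThree.cornerF_three_of_j_eq_zero _ Records.c4356c1_j hr

/-- **`BSD(4356c1, 3)` and `#Ш(4356c1/ℚ)[3^∞] = 1`** from GZK (`hGZK`), `ord_{s=1} L(E,s) ≤ 1`
(`hr`), the two-engine `3`-isogeny-descent certificate `Ш(E/ℚ)[3] = 0` (`h0`; 4356c1: k = -1331, (s_φ, s_φ̂, m, EXCESS) = (1, 0, 1, 0); 4356c3: k = 35937, (s_φ, s_φ̂, m, EXCESS) = (0, 1, 1, 0);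
engines x1b j101548 / sha-2 j103487, agreeing) and `#Ш_an = q`, `ord₃ q = 0` (`hq`, `hv`; Cremona
`#Ш_an`: 4356c1 1, 4356c2 1, 4356c3 1, 4356c4 1). PER CLASS; nothing asserted. [cite: Miller2011LMS, §1 and Def. 1.1]
[cite: Cremona1997, Table 1 (class 4356c)] -/
theorem bsdp_three_c4356c1 (hGZK : rank_eq_analyticRank_of_analyticRank_le_one)
    (hr : Records.c4356c1.analyticRank ≤ 1) (h0 : ∀ x : ↥Records.c4356c1.sha, 3 • x = 0 → x = 0)
    {q : ℚ} (hq : shaAn Records.c4356c1 = (q : ℂ)) (hv : padicValRat 3 q = 0) :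
    BSDp Records.c4356c1 3 ∧ Nat.card (AddCommGroup.primaryComponent Records.c4356c1.sha 3) = 1 :=
  JZeroThree.bsdp_three_of_noThreeTorsion _ hGZK hr h0 hq hv

/-! ### `4563a1 @ 3` (class `4563a`, `N = 4563 = 3³·13²`) -/
namespace Records
/-- Cremona `4563a1 = [0, 0, 1, 0, 92823]`: `y² + y = x³ + 92823` (`N = 4563 = 3³·13²`, `j = 0`, CM by `ℤ[ζ₃]`;
`≅ E_k : y² = x³ + k` with `k = 5940688`; Cremona: rank `1`, `#E(ℚ)_tors = 1`, `∏ c_ℓ = 1`,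
`#Ш_an = 1`). [cite: Cremona1997, Table 1 (curve 4563a1)] -/
def c4563a1 : WeierstrassCurve ℚ := ⟨0, 0, 1, 0, 92823⟩

/-- `4563a1` is an elliptic curve (`Δ = -3722179279923 ≠ 0`). [cite: SilvermanAEC2009, III.1] -/
instance isElliptic_c4563a1 : c4563a1.IsElliptic := by
  have h := isElliptic_of_discOf_ne_zero 0 0 1 0 92823 (by decide)
  norm_num at h; exact h

set_option maxRecDepth 100000 in
/-- `[0, 0, 1, 0, 92823]` is globally minimal (`Δ = -3722179279923`; Kraus–Silverman criterion, kernel-decided).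
[cite: SilvermanAEC2009, VII.1 Remark 1.1 and VIII.8] -/
instance isGloballyMinimal_c4563a1 : c4563a1.IsGloballyMinimal := by
  have h := isGloballyMinimal_of_krausCriterion_bounded 0 0 1 0 92823
    (by decide) (by decide) (by decide +kernel)
  norm_num at h; exact h

/-- `j(4563a1) = 0` (`c₄ = 0`). [cite: Cremona1997, Table 1 (curve 4563a1)] -/
theorem c4563a1_j : c4563a1.j = 0 := by
  have hc4 : c4563a1.c₄ = 0 := by
    norm_num [c4563a1, WeierstrassCurve.c₄, WeierstrassCurve.b₂, WeierstrassCurve.b₄]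
  rw [WeierstrassCurve.j, hc4]
  simp

end Records

/-- **`(4563a1, 3)` is a cell of the leaf `CornerF ∧ CMRamified` at `3`** (CM by `ℚ(√−3)`,
`r_an = 1`, `3` bad and ramified), given `ord_{s=1} L(E,s) = 1` (`hr`; Cremona). [folklore] -/
theorem cornerF_three_c4563a1 (hr : Records.c4563a1.analyticRank = 1) : CornerF Records.c4563a1 3 :=
  JZeroThree.cornerF_three_of_j_eq_zero _ Records.c4563a1_j hr

/-- **`BSD(4563a1, 3)` and `#Ш(4563a1/ℚ)[3^∞] = 1`** from GZK (`hGZK`), `ord_{s=1} L(E,s) ≤ 1`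
(`hr`), the two-engine `3`-isogeny-descent certificate `Ш(E/ℚ)[3] = 0` (`h0`; 4563a1: k = 5940688, (s_φ, s_φ̂, m, EXCESS) = (0, 1, 1, 0); 4563a2: k = -160398576, (s_φ, s_φ̂, m, EXCESS) = (1, 0, 1, 0);
engines x1b j101548 / sha-2 j103487, agreeing) and `#Ш_an = q`, `ord₃ q = 0` (`hq`, `hv`; Cremona
`#Ш_an`: 4563a1 1, 4563a2 1). PER CLASS; nothing asserted. [cite: Miller2011LMS, §1 and Def. 1.1]
[cite: Cremona1997, Table 1 (class 4563a)] -/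
theorem bsdp_three_c4563a1 (hGZK : rank_eq_analyticRank_of_analyticRank_le_one)
    (hr : Records.c4563a1.analyticRank ≤ 1) (h0 : ∀ x : ↥Records.c4563a1.sha, 3 • x = 0 → x = 0)
    {q : ℚ} (hq : shaAn Records.c4563a1 = (q : ℂ)) (hv : padicValRat 3 q = 0) :
    BSDp Records.c4563a1 3 ∧ Nat.card (AddCommGroup.primaryComponent Records.c4563a1.sha 3) = 1 :=
  JZeroThree.bsdp_three_of_noThreeTorsion _ hGZK hr h0 hq hv


end Summit.BirchSwinnertonDyer.Rank1Residual.X12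

end
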